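import Summits.BirchSwinnertonDyer.BirchSwinnertonDyer.Theses.KatoDescentPotSupersingular
import Summits.BirchSwinnertonDyer.BirchSwinnertonDyer.Theorems.KatoDescentPotSupersingularWildUpperOptimalSharpNodes
import HarnessLib

/-!
# Route `KatoDescentPotSupersingular` (rung K9, wild `3`, cell `bsd-potss`): CLOSER of the glue item
# `WildUpperNonsurjTowerOfOptimalSharpRoad` (R100c v2 K9 twin, the U₀-ns node `WildUpperNonsurjTower` re-cut ON THE OPTIMAL
# MEMBER of the class) — one line over this seat's kernel p487595
# (`WildUpperOptimalSharpNodes.wildUpperNonsurjTower_of_jetchevReadings_of_cruxAResidue`); seat `bsd-potss-k8t-c4` g7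
# (courtesy K9). Closes a GLUE item only: the cruxes `JetchevIrreducibleReading` (shared with KT, D-audit PASS ref g28),
# `WildJetchevBoundAtP` (the q = p = 3 B rows, beyond print) and `WildCoatesSujathaResidue` ((A) on the residue classes)
# stay OPEN as typed; BSD is not proved by any of this.

The glue says: the Jetchev irreducible reading (`JetchevIrreducibleReading`, q ≠ 3), its q = 3 twin
(`WildJetchevBoundAtP`), the Heegner-road published inputs (`PublishedInputsHeegner`), Cassels' isogeny invariance
(`PublishedInputCasselsIsogenyRed`), Coates–Sujatha's (A) on the residue classes (`WildCoatesSujathaResidue`), L₀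
(`WildLowerHalfRankZero`), the rank-one residual (`WildRankOne`), `KatoTamagawaExactInputs` and
`PublishedInputsFineSelmerCM` imply the U₀-ns node `WildUpperNonsurjTower` — which is
`WildUpperOptimalSharpNodes.wildUpperNonsurjTower_of_jetchevReadings_of_cruxAResidue` with the Heegner conjunction
destructured.
-/

set_option autoImplicit false
-- the Theorems directory repeats the summit name (sibling precedent `KatoDescentPotSupersingularAssembly.lean`)
set_option linter.dupNamespace false

noncomputable section

namespace Summit.BirchSwinnertonDyer.BirchSwinnertonDyer.Theorems

open Summit.BirchSwinnertonDyer.BirchSwinnertonDyer.Theses.KatoDescentPotSupersingular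

/-- **Closer of the glue item `WildUpperNonsurjTowerOfOptimalSharpRoad`** (type = the route decl BY NAME): destructure the
held Heegner conjunction and apply this seat's optimal-member node
`WildUpperOptimalSharpNodes.wildUpperNonsurjTower_of_jetchevReadings_of_cruxAResidue` (kernel p487595). Glue only; the
three cruxes it consumes stay open; nothing about BSD is asserted. [cite: Jetchev2008, Thm. 1.4, Cor. 1.5 (p. 3), Rem. 6.2 (p. 15)]
[cite: MatarNekovar2019, Thm. 0.3 (p. 456), §0.11 (p. 457)] [cite: MilneADT2006, Thm. I.7.3] -/
theorem wildUpperNonsurjTowerOfOptimalSharpRoad_proof :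
    Summit.BirchSwinnertonDyer.BirchSwinnertonDyer.Theses.KatoDescentPotSupersingular.WildUpperNonsurjTowerOfOptimalSharpRoad :=
  fun hJr hJp hH hC₄ hCS h₂ hR hK hF =>
    WildUpperOptimalSharpNodes.wildUpperNonsurjTower_of_jetchevReadings_of_cruxAResidue
      hJr hJp hH.1 hH.2.1 hH.2.2.1 hH.2.2.2.1 hH.2.2.2.2 hC₄ hCS h₂ hR hK hF

end Summit.BirchSwinnertonDyer.BirchSwinnertonDyer.Theorems

end
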